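import Literature.Topology.PlanarFoliations.PolygonLoop
import HarnessLib

/-!
# The image of the polygon of a cycle of separatrices is a loop of a leaf

Topic: Topology / PlanarFoliations, sequel to `PolygonLoop.lean`. Under the foliated map `g`
of star data, **the polygon of a cycle of separatrices maps to a loop of one leaf of the ambient
foliation `T`, continuous in the leaf topology** (`continuous_toLeafSpace_g_polyTrace`): the
link arcs are leaf arcs of the planar foliation, mapped leafwise by `g ∘ ι`; the prong arcs at a
puncture `v`, together with `v`, lie at the level of `v` (level compatibility of the star), i.e.
in one plaque of the flow box of `v`, where continuity in `M` is leafwise continuity. This gives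
the loop `polyLeafLoop` of the leaf space (a polygon is *essential* when this loop is not
null-homotopic in its leaf).

## References

* C. Camacho, A. Lins Neto, *Geometric Theory of Foliations*, Birkhäuser (1985), Ch. VII §2
  [CamachoLinsNeto1985].
-/

noncomputable section

open Set Filter Function Metric unitInterval
open _root_.Topology
open Literature.Topology.FourManifolds Literature.Topology.FourManifolds.Foliation Literature.Topology.PlaneTopology

namespace Literature.Topology.PlanarFoliations

variable {X : Type*} [TopologicalSpace X] [T2Space X] [SecondCountableTopology X] [Nonempty X] {F : Foliation ℝ X} {ι : X → ℂ}
variable {B : Type*} [NormedAddCommGroup B] {M : Type*} [TopologicalSpace M] {T : Foliation B M} {g : ℂ → M}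
variable {hbi : IsBiOriented F}

namespace StarData

variable (D : StarData F ι T g) (hι : IsOpenEmbedding ι)
variable {m : ℕ} [NeZero m] {C : Set ℂ} (hC : IsCompact C) {vtx : Fin m → ℂ} {sx : Fin m → X}
  [hnc : ∀ i, NoncompactSpace (F.Leaf (sx i))]
  (hv : ∀ i, vtx i ∈ D.P) (hmem : ∀ i, ∀ q : F.Leaf (sx i), ι (Leaf.pt q) ∈ C)
  (hω : ∀ i, omegaSet hbi ι (sx i) = {vtx i}) (hα : ∀ i, alphaSet hbi ι (sx (i + 1)) = {vtx i})

omit [T2Space X] [SecondCountableTopology X] [Nonempty X] in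
/-- **A prong point, like the puncture, is at the level of the puncture**: `g` maps it into the
plaque of the flow box of `v` at the level of `v`. [folklore] -/
theorem g_pt_mem_plaque {v : ℂ} (hv0 : D.nprong v ≠ 0) (j : ZMod (D.nprong v)) {β : ℝ} (hβ : β ∈ Icc 0 (D.star v hv0).ρ) :
    g ((D.star v hv0).pt j (β, 0)) ∈ plaque (D.box v) (D.level v v) := by
  set P := D.star v hv0 with hP
  have hrect : ((β, 0) : ℝ × ℝ) ∈ P.rect := (P.mem_rect_iff).2 ⟨hβ, by simp [P.ρ_pos.le]⟩
  have hS : P.pt j (β, 0) ∈ P.S j := P.pt_mem hrect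
  refine ⟨D.mapsTo_S hv0 j hS, ?_⟩
  show D.level v (P.pt j (β, 0)) = D.level v v
  exact D.level_eq_of_H_eq hv0 hS (P.mem j) (by rw [P.H_pt hrect, P.H_v])

/-- **`g` of the outgoing prong arc is continuous in the leaf topology.** [folklore] -/
theorem continuous_toLeafSpace_g_outArc (i : Fin m) :
    Continuous (toLeafSpace ∘ (g ∘ D.outArc hι hC hv hmem hω hα i) : I → T.LeafSpace) := by
  have hv0 := D.nprong_vtx_ne_zero hC hv hmem hω i (hbi := hbi)
  have hplaque : ∀ u, g (D.outArc hι hC hv hmem hω hα i u) ∈ plaque (D.box (vtx i)) (D.level (vtx i) (vtx i)) := fun u ↦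
    D.g_pt_mem_plaque hv0 _ ((ProngStar.mem_rect_iff _).1 (D.outArc_mem_rect hι hC hv hmem hω hα i u)).1
  refine T.continuous_toLeafSpace_comp_of_forall_mem_plaque ?_ (D.box_mem _ (hv i)) hplaque
  -- continuity in `M`: `g` is continuous on the region, which contains the sectors
  refine D.continuousOn.comp_continuous (D.continuous_outArc hι hC hv hmem hω hα i) fun u ↦ ?_
  exact D.ball_subset _ (hv i) (D.mem_ball_of_mem_S hv0 ((D.star (vtx i) hv0).pt_mem (D.outArc_mem_rect hι hC hv hmem hω hα i u)))

/-- **`g` of the incoming prong arc is continuous in the leaf topology.** [folklore] -/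
theorem continuous_toLeafSpace_g_inArc (i : Fin m) :
    Continuous (toLeafSpace ∘ (g ∘ D.inArc hι hC hv hmem hω hα i) : I → T.LeafSpace) := by
  have hv0 := D.nprong_vtx_ne_zero hC hv hmem hω (i + 1) (hbi := hbi)
  have hplaque : ∀ u, g (D.inArc hι hC hv hmem hω hα i u) ∈ plaque (D.box (vtx (i + 1))) (D.level (vtx (i + 1)) (vtx (i + 1))) :=
    fun u ↦ D.g_pt_mem_plaque hv0 _ ((ProngStar.mem_rect_iff _).1 (D.inArc_mem_rect hι hC hv hmem hω hα i u)).1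
  refine T.continuous_toLeafSpace_comp_of_forall_mem_plaque ?_ (D.box_mem _ (hv (i + 1))) hplaque
  refine D.continuousOn.comp_continuous (D.continuous_inArc hι hC hv hmem hω hα i) fun u ↦ ?_
  exact D.ball_subset _ (hv (i + 1))
    (D.mem_ball_of_mem_S hv0 ((D.star (vtx (i + 1)) hv0).pt_mem (D.inArc_mem_rect hι hC hv hmem hω hα i u)))

/-- **`g` of the link arc is continuous in the leaf topology** (the foliated map on a leaf arc).
[folklore] -/
theorem continuous_toLeafSpace_g_linkArc (i : Fin m) :
    Continuous (toLeafSpace ∘ (g ∘ D.linkArc hι hC hv hmem hω hα i) : I → T.LeafSpace) := by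
  have h := D.foliated.continuous_leafMap.comp (D.continuous_toLeafSpace_cycℓ hι hC hv hmem hω hα i)
  exact h

/-- **`g` of a piece of the polygon is continuous in the leaf topology.** [folklore] -/
theorem continuous_toLeafSpace_g_piece (i : Fin m) :
    Continuous (toLeafSpace ∘ (g ∘ D.piece hι hC hv hmem hω hα i) : I → T.LeafSpace) := by
  have heq : (toLeafSpace ∘ (g ∘ D.piece hι hC hv hmem hω hα i) : I → T.LeafSpace) =
      transFun (transFun (toLeafSpace ∘ (g ∘ D.outArc hι hC hv hmem hω hα i)) (toLeafSpace ∘ (g ∘ D.linkArc hι hC hv hmem hω hα i)))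
        (toLeafSpace ∘ (g ∘ D.inArc hι hC hv hmem hω hα i)) := by
    funext θ
    simp only [comp_apply, piece, ← transFun_map (fun z ↦ (toLeafSpace (g z) : T.LeafSpace))]
    rfl
  rw [heq]
  refine continuous_transFun (continuous_transFun (D.continuous_toLeafSpace_g_outArc hι hC hv hmem hω hα i)
    (D.continuous_toLeafSpace_g_linkArc hι hC hv hmem hω hα i) ?_) (D.continuous_toLeafSpace_g_inArc hι hC hv hmem hω hα i) ?_
  · simp only [comp_apply, D.outArc_one hι hC hv hmem hω hα i]
  · rw [transFun_one]; simp only [comp_apply, D.inArc_zero hι hC hv hmem hω hα i]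

/-- **`g` of the polygon is continuous in the leaf topology.** [folklore] -/
theorem continuous_toLeafSpace_g_polyTrace (k : ℕ) :
    Continuous (toLeafSpace ∘ (g ∘ D.polyTrace hι hC hv hmem hω hα k) : I → T.LeafSpace) := by
  induction k with
  | zero => exact D.continuous_toLeafSpace_g_piece hι hC hv hmem hω hα _
  | succ k ih =>
    have heq : (toLeafSpace ∘ (g ∘ D.polyTrace hι hC hv hmem hω hα (k + 1)) : I → T.LeafSpace) =
        transFun (toLeafSpace ∘ (g ∘ D.polyTrace hι hC hv hmem hω hα k)) (toLeafSpace ∘ (g ∘ D.piece hι hC hv hmem hω hα (idx m (k + 1)))) := by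
      funext θ
      simp only [comp_apply, polyTrace_succ, ← transFun_map (fun z ↦ (toLeafSpace (g z) : T.LeafSpace))]
      rfl
    rw [heq]
    refine continuous_transFun ih (D.continuous_toLeafSpace_g_piece hι hC hv hmem hω hα _) ?_
    simp only [comp_apply, polyTrace_one_apply, piece_zero]

/-- **The leaf loop of the polygon**: `g` of the polygon as a loop of the leaf space of `T` at
`g (vtx 0)`. [folklore] -/
def polyLeafLoop : Path (toLeafSpace (g (vtx (idx m 0))) : T.LeafSpace) (toLeafSpace (g (vtx (idx m 0)))) where
  toFun := toLeafSpace ∘ (g ∘ D.polyTrace hι hC hv hmem hω hα (m - 1))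
  continuous_toFun := D.continuous_toLeafSpace_g_polyTrace hι hC hv hmem hω hα (m - 1)
  source' := by simp only [comp_apply, polyTrace_zero_apply]
  target' := by simp only [comp_apply, ← D.polyTrace_zero_eq_one hι hC hv hmem hω hα, polyTrace_zero_apply]

/-- The values of the leaf loop of the polygon. [folklore] -/
theorem polyLeafLoop_apply (θ : I) :
    D.polyLeafLoop hι hC hv hmem hω hα θ = toLeafSpace (g (D.polyTrace hι hC hv hmem hω hα (m - 1) θ)) := rfl

end StarData

end Literature.Topology.PlanarFoliations
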